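/- Copyright: the b2b-balaban cell (near-miss cell 7), T⁴-continuum fan-out; row NE7b ROUND-2 swarm, seat
t4-ne7b-formalise-leaf-03 (row S12-W «END ∕ headline re-plug over the memory-agnostic carriers» = the row owner's
INTERFACE REQUEST NE7b IR-41-5, `CLAIMS.log` l.27257; custodian lineage leaf-03 of the Mult-END modules; work list
`HOME/b2b-balaban-t4-ne7b-formalise-leaf-03/g21/S12W-WORKLIST-leaf03-g21.md`, site W6).  Released under the licence of
the surrounding project. -/
import Summits.QuantumFields.BalabanUV.T4Continuum.Support.HistoryRealiseCellsRunMultW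
import Summits.QuantumFields.BalabanUV.T4Continuum.Support.HistoryAssemblyMultInstanceW
import Summits.QuantumFields.BalabanUV.T4Continuum.Support.HistoryRealiseCellsRunMultEnd

/-!
# THE LAST JUNCTION over the MEMORY-AGNOSTIC domain carrier `RealisedDomainsRW` — twin of
`HistoryRealiseCellsRunMultEnd` (S12-W, W6)

Summits-side support leaf of the T⁴-continuum cell (rung (B)+1 on a FINITE torus only; NOT infinite volume, NOT the
mass gap, NOT the Clay statement; NOT a proof of the spine estimate NE7b, which is the cell's OWN estimate, NOT PRINTED
and NOT PROVED).

WHY.  `HistoryRealiseCellsRunMultEnd.hybridNE7_of_realisedDomainsRun_printedT3b` (this lineage; on the headline-of-record path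
`PinnedT3b(P) ← MultEnd(P)D ← MultEnd(P) ← {MultInstance, CellsRunMult(P)}`) reads the class-R binder `realised` as
leaf-08's `RealisedDomainsR F.L (runProfile F.L R) …`, whose field `real := Realises … ∧ PendingAt … K` carries the row
owner's two located MODEL findings (F-ne7bp1g40-1: pendency one index stronger than print; #3 = R-OWNER-41-1: condition
(ii)'s memory FROZEN at the last event vs print's CURRENT `R_j` — B16 = [Balaban1989LargeFieldII] pp. 383–387, B15 =
[Balaban1989LargeFieldI] pp. 177, 198, manuscripts UNDER AUDIT, locators only, nothing of them asserted).  Repair route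
R-41-a (the END must not depend on the readiness CONVENTION; append-only twin chain over the owner's core
`HistoryRealiseWeak` p248661): THIS FILE is the by-name twin over `HistoryRealiseWeakCells.RealisedDomainsRW` (IR-41-4
file 3, p250828), with every reading-dependent supplier replaced by its W-twin — the Mult ENDs of S12-W W4∕W5∕W10, row
S6g′'s instance `HistoryAssemblyMultInstanceW.card_koccOf_le_expW` ∕ `hdisV_of_domainsRW` (W3, over leaf-05's J-layer
Z-twins and leaf-07's zone skeleton) — and everything else VERBATIM; conclusion IDENTICAL.  The landed END stays and is
the special case through `RealisedDomainsR.toW`.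

WHAT.  **`hybridNE7_of_realisedDomainsRunW_printedT3b`**.  [folklore] composition by name; no definition, no `[cite:]` tag, nothing
printed asserted, zero `sorry`.

HONEST.  DISPLAYED, NOT DISCHARGED: the reading H3^NE7b as `RealisedDomainsRW` (`real`, `track`, `disjoint`, `inBox` — the
owner's M4 is the road that discharges them, NOT this file) + the per-component displays `hstep`, `hdis` ∕ `hDJ`∕`hBB`, (B)
at fixed volume, the BetaPertH-flow box bounds + tuning + IR smallness, NE7c's `ShellWeightBound`, NE7's `ReindexedBudget`
with four summable rates, the discounted printed price sentences and the `Regeneration` numerator readings.  By-name class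
of every `WALL-NE7b-P1.md` §2 binder UNCHANGED; headline p224237 UNCHANGED BY NAME (its W twin needs leaf-02's pinned ∕
apex ∕ headline W-files over THESE ENDs); NE7b NOT PRINTED ∕ NOT PROVED; spine 0∕9.  HONEST DEPENDENCY (cell): continuum YM
on T⁴ ⇐ BetaPertH ∧ nine spine estimates (0/9 proved); BetaPertH ⇐ (D1) ∧ (D4) ∧ CAP+tail; G-an2-4 gates asym, D1 and
NE2/3/4.  This file changes none of it. -/

open Finset MeasureTheory
open Literature.MathematicalPhysics.QuantumFieldTheory.Balaban1983to89
open T4PersistenceDictionary T4PersistentHistoryCount T4BankedInduction T4PrintedShapeBanking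
open T4WeightBudget T4GlobalDenominator T4LiveClassFibration T4LiveStructureGas T4LiveGasToTerms T4RecordPriceSeam
open T4PartnerMultiplicity T4IndicatorShell T4MatchingAssembly T4MatchingClosure T4MatchingClosureSocket T4Continuum
open T4StabilitySocket T4BranchingRecordsGas T4TaggedShapeBanking T4CanonicalMenus T4RenewalChains
open Summit.QuantumFields.BalabanUV.T4Continuum.PlacementBatch
open Summit.QuantumFields.BalabanUV.T4Continuum.PlacementSkeleton
open Summit.QuantumFields.BalabanUV.T4Continuum.CountThresholdUniform
open Summit.QuantumFields.BalabanUV.T4Continuum.CountThresholdExit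
open Summit.QuantumFields.BalabanUV.T4Continuum.CountSeamJunction
open Summit.QuantumFields.BalabanUV.T4Continuum.LateMergers
open Summit.QuantumFields.BalabanUV.T4Continuum.HistoryFlow
open Summit.QuantumFields.BalabanUV.T4Continuum.HistoryRegeneration
open Summit.QuantumFields.BalabanUV.T4Continuum.HistoryTables
open Summit.QuantumFields.BalabanUV.T4Continuum.HistoryAssemblyTrees
open Summit.QuantumFields.BalabanUV.T4Continuum.HistoryAssemblyTerms
open Summit.QuantumFields.BalabanUV.T4Continuum.HistoryAssemblyPedigree
open Summit.QuantumFields.BalabanUV.T4Continuum.HistoryConstants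
open Summit.QuantumFields.BalabanUV.T4Continuum.HistoryGen
open Literature.MathematicalPhysics.QuantumFieldTheory.Balaban1983to89.B13ScaleTransfer
open Summit.QuantumFields.BalabanUV.T4Continuum.ZoneSkeleton
open Summit.QuantumFields.BalabanUV.T4Continuum.HistorySocketTH
open Summit.QuantumFields.BalabanUV.T4Continuum.HistoryCaps
open Summit.QuantumFields.BalabanUV.T4Continuum.HistoryAssemblyPrice
open Summit.QuantumFields.BalabanUV.T4Continuum.HistoryBankingLE
open Summit.QuantumFields.BalabanUV.T4Continuum.HistoryExitLE
open Summit.QuantumFields.BalabanUV.T4Continuum.HistoryAssemblyTreesLE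
open Summit.QuantumFields.BalabanUV.T4Continuum.HistoryAssemblyTermsLE
open Summit.QuantumFields.BalabanUV.T4Continuum.HistoryRealise
open Summit.QuantumFields.BalabanUV.T4Continuum.HistoryAssemblyRealiseLE
open Summit.QuantumFields.BalabanUV.T4Continuum.HistoryAssemblyMult
open Summit.QuantumFields.BalabanUV.T4Continuum.HistoryAssemblyMultKey
open Summit.QuantumFields.BalabanUV.T4Continuum.HistoryAssemblyRealiseRun
open Summit.QuantumFields.BalabanUV.T4Continuum.HistoryAssemblyRealiseMult
open Summit.QuantumFields.BalabanUV.T4Continuum.HistoryZones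
open Summit.QuantumFields.BalabanUV.T4Continuum.HistoryRealiseCells
open Summit.QuantumFields.BalabanUV.T4Continuum.HistoryRealiseCellsRun
open Summit.QuantumFields.BalabanUV.T4Continuum.HistoryAssemblyRealiseRunMult

open Summit.QuantumFields.BalabanUV.T4Continuum.HistoryRealiseCellsRunMult
open Summit.QuantumFields.BalabanUV.T4Continuum.HistoryAssemblyMultInstance
open Summit.QuantumFields.BalabanUV.T4Continuum.HistoryJoinsPlacedMember
open Summit.QuantumFields.BalabanUV.T4Continuum.PlacementSkeleton
open Summit.QuantumFields.BalabanUV.T4Continuum.HistoryJoinsPlacedMult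
open Summit.QuantumFields.BalabanUV.T4Continuum.HistoryRealiseDistinct
open Summit.QuantumFields.BalabanUV.T4Continuum.HistoryRegionTemplates
open Summit.QuantumFields.BalabanUV.T4Continuum.HistoryCaps
open Summit.QuantumFields.BalabanUV.T4Continuum.HistoryZoneEvolve (cth)
open Literature.MathematicalPhysics.QuantumFieldTheory.Balaban1983to89.B16SProfile (DropCtl)
open Summit.QuantumFields.BalabanUV.T4Continuum.HistoryRealisePrint
open Summit.QuantumFields.BalabanUV.T4Continuum.HistoryRealiseWeak
open Summit.QuantumFields.BalabanUV.T4Continuum.HistoryRealiseWeakReading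
open Summit.QuantumFields.BalabanUV.T4Continuum.HistoryRealiseWeakCells
open Summit.QuantumFields.BalabanUV.T4Continuum.HistoryAssemblyRealiseRunMultW
open Summit.QuantumFields.BalabanUV.T4Continuum.HistoryAssemblyMultInstanceW
open Summit.QuantumFields.BalabanUV.T4Continuum.HistoryRealiseCellsRunMultW
open Summit.QuantumFields.BalabanUV.T4Continuum.HistoryRealiseCellsRunMultEnd

namespace Summit.QuantumFields.BalabanUV.T4Continuum.HistoryRealiseCellsRunMultEndW

noncomputable section

section End

variable {F : T4Family} {G : Type*} [GaugeGroup G] [MeasurableSpace G] [HaarData G] [RegularGaugeGroup G]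
variable {α π : Type*} [DecidableEq α] [DecidableEq π]
variable {ι : Type*} [DecidableEq ι] {l₀ vol : ℝ} {K₀ : ℕ} {T : ℕ → Finset ι} {A A' shA shB : ℕ → ℝ → ι → ℝ}
  {dead dead' : ℕ → ℝ → ι → ℝ} {nup mup : ℕ → ℝ → ℝ} {Nup : ℝ}
  {Cc Rr CcRec RrRec : ℕ → ℝ → ι → ℝ} {ν u s₂ q₀ r s Wsh : ℕ → ℝ}

/-- **MEMORY-AGNOSTIC TWIN (S12-W W6)** of `HistoryRealiseCellsRunMultEnd.hybridNE7_of_realisedDomainsRun_printedT3b`: the SAME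
statement with `RealisedDomainsR ↦ RealisedDomainsRW` (IR-41-4 file 3) in the hypothesis, every supplier replaced by its W-twin
(S12-W W3∕W4∕W5∕W10 and earlier MultEnd W-files); conclusion VERBATIM.  The landed docstring follows.  **NE7b's COUNT EXIT — END-A: THE END OF RECORD v2 WITH THE SLOT MULTIPLICITY DISCHARGED BY ROW S6g′'s
INSTANCE, `hdis` DISPLAYED** (the LAST JUNCTION «S12e END v2 × T3b», owner's claim table v3.33 (3)).
= `HistoryRealiseCellsRunMult.hybridNE7_of_realisedDomainsRun_printedMult` (p219539) with the physical datum OF RECORD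
`phys := physV …` (leaf-05 gen 4, R-OWNER-23-5 (2): the multiset of birth VALUES read cutoff-free, template capacity
READ OFF THE DATA `tcap d (dcapOf …)`), the homes `Λm := (F.L)^d`, `Λr := 1`,
`Ξ K q := 8∕C.E₂·totalCostT Prod.fst C K (R K) q.2 + 4·partnerAges (PEv.step ∘ Prod.fst) q.2` (DISPLAYED: the discount
`exp(−Ξ K q)` in `hPM`∕`hPM′` — print's renewal-entropy discount READ + `4` per partner-age unit DISPLACED from the
count, T-NE7b-14), and `hmult` SUPPLIED by `HistoryAssemblyMultInstance.card_koccOf_le_exp` (T3b-5 `card_koccOf_le` ×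
twin END `card_S_sortR_le_exp_pow` × the letters).  Binder diff against p219539: only-in-Mult {`phys`, `Λm Λr hΛm hΛr
hΛmr`, `Ξ`, `hmult`}; only-in-A {`hstep`, `hdis`, `hE₂ hE₃`, `sS hsS hsmall`, `θc hθc0 hθc1 hθcs`, `hθJ`}; `hPM`∕`hPM′` at
`Λr := 1` with the explicit discount; conclusion IDENTICAL. [folklore] -/
theorem hybridNE7_of_realisedDomainsRunW_printedT3b (D : FiniteEpsData F G) {C : T4PrintedShapeBanking.Consts}
    {O : PrintedO1s}
    {rr : ℕ} {β₀ : ℝ} (h : ThresholdOK C F.L rr β₀) (hμ : 0 < C.μ) (d n : ℕ)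
    (hκ₁ : (d : ℝ) * Real.log F.L + 2 * Real.log 2 ≤ C.κ₁) (hE₀ : Real.log (2 + birthMass C) ≤ C.E₀)
    -- the profile floor `p₀(g) ≥ 1` along the runs comes from `1 ≤ A₀` and the flow's `log g⁻² ≥ 1`
    (hA₀ : 1 ≤ C.A₀)
    -- the flow side (⇐ BetaPertH, displayed) and tuning
    {γ₀ γb b β' : ℝ} {pe : ℕ} (hb : 0 ≤ b) (hlo : FlowStep.BetaLowerH b γ₀ D.βfun)
    (hhi : FlowStep.BetaUpperH β' γ₀ D.βfun) (hγ : γb ≤ γ₀) (hγβ : γb ^ 2 * β' < 1)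
    (S : B14FlowStep.SmallnessFor γb β' β₀ F.L pe) (hp₀ : C.p₀ ≤ pe) (hrr : rr ≤ pe) (hβ : β₀ ≤ 1 / 2)
    {g : ℝ} {g₀ : ℕ → ℝ} (ht : D.Tuned γb g g₀)
    (hir : irThresholdTLE C F.L rr β₀ ≤ Real.log (g ^ 2)⁻¹)
    -- the (B) side
    (hsign : B16.SignConventions D.C) {γB : ℝ} {em ep : ℝ → ℝ} (hcor : B16.Cor3With D.C γB em ep) (hγB : γb ≤ γB)
    {obs : (K : ℕ) → GaugeField (F.P K) 0 G → ℝ} {B : ℝ}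
    (hobs : ∀ K, Measurable (obs K)) (hbd : ∀ K U, |obs K U| ≤ B)
    (hα : ∀ K t, |t| ≤ l₀ → K₀ ≤ K →
      ∫ U, Real.exp (t * obs K U) * D.dens K (g₀ K) 0 U ∂fieldMeasure (F.P K) 0 G ≤ ∑ τ ∈ T K, A K t τ)
    (hα' : ∀ K t, |t| ≤ l₀ → K₀ ≤ K →
      ∫ U, Real.exp (t * obs (K + 1) U) * D.dens (K + 1) (g₀ (K + 1)) 0 U ∂fieldMeasure (F.P (K + 1)) 0 G ≤
        ∑ τ ∈ T K, A' K t τ)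
    {c₀ n₁ : ℝ} (hc₀ : 0 < c₀) (hfloor : ∀ K, K₀ ≤ K → c₀ ≤ smallFieldMass D K (g₀ K))
    (hfloor' : ∀ K, K₀ ≤ K → c₀ ≤ smallFieldMass D (K + 1) (g₀ (K + 1)))
    (hsites : ∀ K, K₀ ≤ K → ((D.C ⟨K, F.m, g₀ K⟩).numSites K : ℝ) ≤ n₁)
    (hsites' : ∀ K, K₀ ≤ K → ((D.C ⟨K + 1, F.m, g₀ (K + 1)⟩).numSites (K + 1) : ℝ) ≤ n₁)
    (hNup : 0 ≤ Nup) (hnup : ∀ K t, |t| ≤ l₀ → K₀ ≤ K → 0 ≤ nup K t ∧ nup K t ≤ Nup)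
    (hmup : ∀ K t, |t| ≤ l₀ → K₀ ≤ K → 0 ≤ mup K t ∧ mup K t ≤ Nup)
    -- the (2.5) side condition on the size function
    (R : ℕ → ℕ → ℕ) (hR : ∀ K s, s ≤ K → B14.IsRj F.L rr ((D.C ⟨K, F.m, g₀ K⟩).flow.g s) (R K s))
    -- the side conditions of the geometric lemmas (row S1b): torus side, window constant, sizes (NO drop control)
    (hL4 : 4 ≤ F.L) (hn₁ : 13 ≤ C.n₁) (hR1 : ∀ K, K₀ ≤ K → ∀ t, 1 ≤ R K t)
    -- H3: the terms read as pedigrees REALISED BY THE RUN'S OWN PROFILE with their DOMAINS (root cells := `cellOfR`)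
    (ped : ℕ → ι → Pedigree α π) (cellP : ℕ → ι → π → Pt d × Finset (Pt d)) (liveC : ℕ → ι → Finset α)
    (Zd : ℕ → ι → α → Finset (Pt d)) (H : RealisedDomainsRW F.L (runProfile F.L R) n K₀ R T ped cellP liveC Zd)
    (hn : 0 < n)
    -- H3: live components are dated no later than the cutoff; the bad terms' live components have DUPLICATE-FREE
    -- birth-value multisets (R-OWNER-23-6, letters of record `physV`)
    (hstep : ∀ K, K₀ ≤ K → ∀ τ ∈ T K, ∀ c ∈ liveC K τ, (ped K τ).step c ≤ K)
    (hdis : ∀ K, K₀ ≤ K → ∀ τ ∈ badTerms (memOf ped liveC (cellOfR n F.L (runProfile F.L R) ped cellP)) jhalf T K,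
      ∀ c ∈ liveC K τ, ((physV n F.L hn (Nat.lt_of_lt_of_le Nat.zero_lt_two (two_le_L F))
        (fun K => tcap d (dcapOf Prod.fst T (memOf ped liveC (cellOfR n F.L (runProfile F.L R) ped cellP)) K))
        (fun K => one_le_tcap d (dcapOf Prod.fst T (memOf ped liveC (cellOfR n F.L (runProfile F.L R) ped cellP)) K)) (runProfile F.L R) ped cellP) K τ c).Nodup)
    -- the class-linear slack: `C.a + θ ≤ ½γ₀A₁²` pays the factor `e^{θ·birthLinT}` of the slot multiplicity
    {θ : ℝ} (hθ : 0 ≤ θ) (hslack : C.a + θ ≤ O.γ₀ * O.A₁ ^ 2 / 2)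
    -- row S6g′'s INSTANCE: the count's stride `sS` and decay `θc` with their arithmetic side conditions (symbolic), the
    -- signs of the floor ∕ size constants, and `θ` above the instance's class-linear constant (twin END at collar 32 +
    -- the root-template slope)
    (hE₂ : 0 < C.E₂) (hE₃ : 0 ≤ C.E₃) {sS : ℕ} (hsS : 1 ≤ sS)
    (hsmall : (((2 * cth 32 1 sS + 1) ^ d : ℕ) : ℝ) * (5 : ℝ) ^ d * ((max 1 (2 * 32 + 2) : ℕ) : ℝ) ≤
      (F.L : ℝ) ^ (sS / 2) / 2)
    {θc : ℝ} (hθc0 : 0 ≤ θc) (hθc1 : θc < 1) (hθcs : 1 / 2 ≤ θc ^ sS)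
    (hθJ : (2 +
            ((2 * (((2 * cth 32 1 sS + 1) ^ d : ℕ) : ℝ) * ((((2 * 32 + 1) ^ d : ℕ) : ℝ) * (4 * 2 ^ d)) +
                  4 * ((((2 * cth 32 1 sS + 1) ^ d : ℕ) : ℝ) * (5 : ℝ) ^ d)) / (1 - θc) +
              2 * (2 * ((((2 * cth 32 1 sS + 1) ^ d : ℕ) : ℝ) * (5 : ℝ) ^ d))) +
            (2 * ((0 + 2 * Real.log (2 * d + 1)) + (2 * (d : ℝ) + 2 * Real.log (2 * d + 1)) *
                  (((max 1 (2 * 32 + 2) : ℕ) : ℝ) * (2 * ((((2 * cth 32 1 sS + 1) ^ d : ℕ) : ℝ) * (5 : ℝ) ^ d)))) +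
              (2 * (d : ℝ) + 2 * Real.log (2 * d + 1)) * 1 *
                (((max 1 (2 * 32 + 2) : ℕ) : ℝ) *
                    ((2 * (((2 * cth 32 1 sS + 1) ^ d : ℕ) : ℝ) * ((((2 * 32 + 1) ^ d : ℕ) : ℝ) * (4 * 2 ^ d)) +
                        4 * ((((2 * cth 32 1 sS + 1) ^ d : ℕ) : ℝ) * (5 : ℝ) ^ d)) / (1 - θc)) +
                  4 * 2 ^ d)) +
            10) + 8 * 2 ^ d * Real.log (2 * d + 1) ≤ θ)
    -- H3: realised per-step costs of the live members, read below the model's booked cost (reading (ID-a))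
    (κ κ' : ℕ → (Fin d → ℕ) × Gen (Lab α π) → Gen (Lab α π) → ℕ → ℝ)
    (hκ : ∀ K, K₀ ≤ K → ∀ τ ∈ badTerms (memOf ped liveC (cellOfR n F.L (runProfile F.L R) ped cellP)) jhalf T K, ∀ q ∈ memOf ped liveC (cellOfR n F.L (runProfile F.L R) ped cellP) K τ,
      ∀ m ∈ life (padW (dictWT Prod.fst (R K) C.n₁) 0) q.2,
        κ K q q.2 m ≤ costT Prod.fst C K (R K) q.2 m)
    (hκ' : ∀ K, K₀ ≤ K → ∀ τ ∈ badTerms (memOf ped liveC (cellOfR n F.L (runProfile F.L R) ped cellP)) jhalf T K, ∀ q ∈ memOf ped liveC (cellOfR n F.L (runProfile F.L R) ped cellP) K τ,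
      ∀ m ∈ life (padW (dictWT Prod.fst (R K) C.n₁) 0) q.2,
        κ' K q q.2 m ≤ costT Prod.fst C K (R K) q.2 m)
    -- H3: the per-term price sentence over the named members in PRINT's currency, discounted by the allowance; the
    -- live price of the PHYSICAL member family; both runs
    {FcM RfM FcM' RfM' : ℕ → Finset ((Fin d → ℕ) × Gen PEv × Multiset (PEv × ((Fin d → ℕ) × Finset (Pt d)))) → ℝ}
    (hPM : ∀ K t, |t| ≤ l₀ → K₀ ≤ K → ∀ τ ∈ badTerms (memOf ped liveC (cellOfR n F.L (runProfile F.L R) ped cellP)) jhalf T K,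
      FcM K (kmemOf ped liveC (cellOfR n F.L (runProfile F.L R) ped cellP) (physV n F.L hn (Nat.lt_of_lt_of_le Nat.zero_lt_two (two_le_L F))
        (fun K => tcap d (dcapOf Prod.fst T (memOf ped liveC (cellOfR n F.L (runProfile F.L R) ped cellP)) K))
        (fun K => one_le_tcap d (dcapOf Prod.fst T (memOf ped liveC (cellOfR n F.L (runProfile F.L R) ped cellP)) K)) (runProfile F.L R) ped cellP) K τ) * RfM K (kmemOf ped liveC (cellOfR n F.L (runProfile F.L R) ped cellP) (physV n F.L hn (Nat.lt_of_lt_of_le Nat.zero_lt_two (two_le_L F))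
        (fun K => tcap d (dcapOf Prod.fst T (memOf ped liveC (cellOfR n F.L (runProfile F.L R) ped cellP)) K))
        (fun K => one_le_tcap d (dcapOf Prod.fst T (memOf ped liveC (cellOfR n F.L (runProfile F.L R) ped cellP)) K)) (runProfile F.L R) ped cellP) K τ) ≤
        ∏ q ∈ memOf ped liveC (cellOfR n F.L (runProfile F.L R) ped cellP) K τ,
          pshapeTH Prod.fst O C 1 1 (R K) (D.C ⟨K, F.m, g₀ K⟩).flow.g 0 (κ K q) q.2 * Real.exp (-(8 / C.E₂ * totalCostT Prod.fst C K (R K) q.2 + 4 * (partnerAges (PEv.step ∘ Prod.fst) q.2 : ℝ))))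
    (hPM' : ∀ K t, |t| ≤ l₀ → K₀ ≤ K → ∀ τ ∈ badTerms (memOf ped liveC (cellOfR n F.L (runProfile F.L R) ped cellP)) jhalf T K,
      FcM' K (kmemOf ped liveC (cellOfR n F.L (runProfile F.L R) ped cellP) (physV n F.L hn (Nat.lt_of_lt_of_le Nat.zero_lt_two (two_le_L F))
        (fun K => tcap d (dcapOf Prod.fst T (memOf ped liveC (cellOfR n F.L (runProfile F.L R) ped cellP)) K))
        (fun K => one_le_tcap d (dcapOf Prod.fst T (memOf ped liveC (cellOfR n F.L (runProfile F.L R) ped cellP)) K)) (runProfile F.L R) ped cellP) K τ) * RfM' K (kmemOf ped liveC (cellOfR n F.L (runProfile F.L R) ped cellP) (physV n F.L hn (Nat.lt_of_lt_of_le Nat.zero_lt_two (two_le_L F))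
        (fun K => tcap d (dcapOf Prod.fst T (memOf ped liveC (cellOfR n F.L (runProfile F.L R) ped cellP)) K))
        (fun K => one_le_tcap d (dcapOf Prod.fst T (memOf ped liveC (cellOfR n F.L (runProfile F.L R) ped cellP)) K)) (runProfile F.L R) ped cellP) K τ) ≤
        ∏ q ∈ memOf ped liveC (cellOfR n F.L (runProfile F.L R) ped cellP) K τ,
          pshapeTH Prod.fst O C 1 1 (R K) (D.C ⟨K, F.m, g₀ K⟩).flow.g 0 (κ' K q) q.2 * Real.exp (-(8 / C.E₂ * totalCostT Prod.fst C K (R K) q.2 + 4 * (partnerAges (PEv.step ∘ Prod.fst) q.2 : ℝ))))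
    -- H3: the remaining `Regeneration` numerator readings, over the PHYSICAL member families of the bad terms
    (upM : ∀ K t, |t| ≤ l₀ → K₀ ≤ K →
      ∀ k ∈ badGMems (memOf ped liveC (cellOfR n F.L (runProfile F.L R) ped cellP)) jhalf T (kmemOf ped liveC (cellOfR n F.L (runProfile F.L R) ped cellP) (physV n F.L hn (Nat.lt_of_lt_of_le Nat.zero_lt_two (two_le_L F))
        (fun K => tcap d (dcapOf Prod.fst T (memOf ped liveC (cellOfR n F.L (runProfile F.L R) ped cellP)) K))
        (fun K => one_le_tcap d (dcapOf Prod.fst T (memOf ped liveC (cellOfR n F.L (runProfile F.L R) ped cellP)) K)) (runProfile F.L R) ped cellP)) K,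
        ∀ τ ∈ fibre (kmemOf ped liveC (cellOfR n F.L (runProfile F.L R) ped cellP) (physV n F.L hn (Nat.lt_of_lt_of_le Nat.zero_lt_two (two_le_L F))
        (fun K => tcap d (dcapOf Prod.fst T (memOf ped liveC (cellOfR n F.L (runProfile F.L R) ped cellP)) K))
        (fun K => one_le_tcap d (dcapOf Prod.fst T (memOf ped liveC (cellOfR n F.L (runProfile F.L R) ped cellP)) K)) (runProfile F.L R) ped cellP)) T K k, A K t τ ≤ dead K t τ * FcM K k * nup K t)
    (deadM_nonneg : ∀ K t, |t| ≤ l₀ → K₀ ≤ K →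
      ∀ k ∈ badGMems (memOf ped liveC (cellOfR n F.L (runProfile F.L R) ped cellP)) jhalf T (kmemOf ped liveC (cellOfR n F.L (runProfile F.L R) ped cellP) (physV n F.L hn (Nat.lt_of_lt_of_le Nat.zero_lt_two (two_le_L F))
        (fun K => tcap d (dcapOf Prod.fst T (memOf ped liveC (cellOfR n F.L (runProfile F.L R) ped cellP)) K))
        (fun K => one_le_tcap d (dcapOf Prod.fst T (memOf ped liveC (cellOfR n F.L (runProfile F.L R) ped cellP)) K)) (runProfile F.L R) ped cellP)) K,
        ∀ τ ∈ fibre (kmemOf ped liveC (cellOfR n F.L (runProfile F.L R) ped cellP) (physV n F.L hn (Nat.lt_of_lt_of_le Nat.zero_lt_two (two_le_L F))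
        (fun K => tcap d (dcapOf Prod.fst T (memOf ped liveC (cellOfR n F.L (runProfile F.L R) ped cellP)) K))
        (fun K => one_le_tcap d (dcapOf Prod.fst T (memOf ped liveC (cellOfR n F.L (runProfile F.L R) ped cellP)) K)) (runProfile F.L R) ped cellP)) T K k, 0 ≤ dead K t τ)
    (resumM : ∀ K t, |t| ≤ l₀ → K₀ ≤ K →
      ∀ k ∈ badGMems (memOf ped liveC (cellOfR n F.L (runProfile F.L R) ped cellP)) jhalf T (kmemOf ped liveC (cellOfR n F.L (runProfile F.L R) ped cellP) (physV n F.L hn (Nat.lt_of_lt_of_le Nat.zero_lt_two (two_le_L F))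
        (fun K => tcap d (dcapOf Prod.fst T (memOf ped liveC (cellOfR n F.L (runProfile F.L R) ped cellP)) K))
        (fun K => one_le_tcap d (dcapOf Prod.fst T (memOf ped liveC (cellOfR n F.L (runProfile F.L R) ped cellP)) K)) (runProfile F.L R) ped cellP)) K,
        ∑ τ ∈ fibre (kmemOf ped liveC (cellOfR n F.L (runProfile F.L R) ped cellP) (physV n F.L hn (Nat.lt_of_lt_of_le Nat.zero_lt_two (two_le_L F))
        (fun K => tcap d (dcapOf Prod.fst T (memOf ped liveC (cellOfR n F.L (runProfile F.L R) ped cellP)) K))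
        (fun K => one_le_tcap d (dcapOf Prod.fst T (memOf ped liveC (cellOfR n F.L (runProfile F.L R) ped cellP)) K)) (runProfile F.L R) ped cellP)) T K k, dead K t τ ≤ RfM K k)
    (FM_nonneg : ∀ K t, |t| ≤ l₀ → K₀ ≤ K →
      ∀ k ∈ badGMems (memOf ped liveC (cellOfR n F.L (runProfile F.L R) ped cellP)) jhalf T (kmemOf ped liveC (cellOfR n F.L (runProfile F.L R) ped cellP) (physV n F.L hn (Nat.lt_of_lt_of_le Nat.zero_lt_two (two_le_L F))
        (fun K => tcap d (dcapOf Prod.fst T (memOf ped liveC (cellOfR n F.L (runProfile F.L R) ped cellP)) K))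
        (fun K => one_le_tcap d (dcapOf Prod.fst T (memOf ped liveC (cellOfR n F.L (runProfile F.L R) ped cellP)) K)) (runProfile F.L R) ped cellP)) K, 0 ≤ FcM K k)
    (upM' : ∀ K t, |t| ≤ l₀ → K₀ ≤ K →
      ∀ k ∈ badGMems (memOf ped liveC (cellOfR n F.L (runProfile F.L R) ped cellP)) jhalf T (kmemOf ped liveC (cellOfR n F.L (runProfile F.L R) ped cellP) (physV n F.L hn (Nat.lt_of_lt_of_le Nat.zero_lt_two (two_le_L F))
        (fun K => tcap d (dcapOf Prod.fst T (memOf ped liveC (cellOfR n F.L (runProfile F.L R) ped cellP)) K))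
        (fun K => one_le_tcap d (dcapOf Prod.fst T (memOf ped liveC (cellOfR n F.L (runProfile F.L R) ped cellP)) K)) (runProfile F.L R) ped cellP)) K,
        ∀ τ ∈ fibre (kmemOf ped liveC (cellOfR n F.L (runProfile F.L R) ped cellP) (physV n F.L hn (Nat.lt_of_lt_of_le Nat.zero_lt_two (two_le_L F))
        (fun K => tcap d (dcapOf Prod.fst T (memOf ped liveC (cellOfR n F.L (runProfile F.L R) ped cellP)) K))
        (fun K => one_le_tcap d (dcapOf Prod.fst T (memOf ped liveC (cellOfR n F.L (runProfile F.L R) ped cellP)) K)) (runProfile F.L R) ped cellP)) T K k, A' K t τ ≤ dead' K t τ * FcM' K k * mup K t)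
    (deadM'_nonneg : ∀ K t, |t| ≤ l₀ → K₀ ≤ K →
      ∀ k ∈ badGMems (memOf ped liveC (cellOfR n F.L (runProfile F.L R) ped cellP)) jhalf T (kmemOf ped liveC (cellOfR n F.L (runProfile F.L R) ped cellP) (physV n F.L hn (Nat.lt_of_lt_of_le Nat.zero_lt_two (two_le_L F))
        (fun K => tcap d (dcapOf Prod.fst T (memOf ped liveC (cellOfR n F.L (runProfile F.L R) ped cellP)) K))
        (fun K => one_le_tcap d (dcapOf Prod.fst T (memOf ped liveC (cellOfR n F.L (runProfile F.L R) ped cellP)) K)) (runProfile F.L R) ped cellP)) K,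
        ∀ τ ∈ fibre (kmemOf ped liveC (cellOfR n F.L (runProfile F.L R) ped cellP) (physV n F.L hn (Nat.lt_of_lt_of_le Nat.zero_lt_two (two_le_L F))
        (fun K => tcap d (dcapOf Prod.fst T (memOf ped liveC (cellOfR n F.L (runProfile F.L R) ped cellP)) K))
        (fun K => one_le_tcap d (dcapOf Prod.fst T (memOf ped liveC (cellOfR n F.L (runProfile F.L R) ped cellP)) K)) (runProfile F.L R) ped cellP)) T K k, 0 ≤ dead' K t τ)
    (resumM' : ∀ K t, |t| ≤ l₀ → K₀ ≤ K →
      ∀ k ∈ badGMems (memOf ped liveC (cellOfR n F.L (runProfile F.L R) ped cellP)) jhalf T (kmemOf ped liveC (cellOfR n F.L (runProfile F.L R) ped cellP) (physV n F.L hn (Nat.lt_of_lt_of_le Nat.zero_lt_two (two_le_L F))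
        (fun K => tcap d (dcapOf Prod.fst T (memOf ped liveC (cellOfR n F.L (runProfile F.L R) ped cellP)) K))
        (fun K => one_le_tcap d (dcapOf Prod.fst T (memOf ped liveC (cellOfR n F.L (runProfile F.L R) ped cellP)) K)) (runProfile F.L R) ped cellP)) K,
        ∑ τ ∈ fibre (kmemOf ped liveC (cellOfR n F.L (runProfile F.L R) ped cellP) (physV n F.L hn (Nat.lt_of_lt_of_le Nat.zero_lt_two (two_le_L F))
        (fun K => tcap d (dcapOf Prod.fst T (memOf ped liveC (cellOfR n F.L (runProfile F.L R) ped cellP)) K))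
        (fun K => one_le_tcap d (dcapOf Prod.fst T (memOf ped liveC (cellOfR n F.L (runProfile F.L R) ped cellP)) K)) (runProfile F.L R) ped cellP)) T K k, dead' K t τ ≤ RfM' K k)
    (FM'_nonneg : ∀ K t, |t| ≤ l₀ → K₀ ≤ K →
      ∀ k ∈ badGMems (memOf ped liveC (cellOfR n F.L (runProfile F.L R) ped cellP)) jhalf T (kmemOf ped liveC (cellOfR n F.L (runProfile F.L R) ped cellP) (physV n F.L hn (Nat.lt_of_lt_of_le Nat.zero_lt_two (two_le_L F))
        (fun K => tcap d (dcapOf Prod.fst T (memOf ped liveC (cellOfR n F.L (runProfile F.L R) ped cellP)) K))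
        (fun K => one_le_tcap d (dcapOf Prod.fst T (memOf ped liveC (cellOfR n F.L (runProfile F.L R) ped cellP)) K)) (runProfile F.L R) ped cellP)) K, 0 ≤ FcM' K k)
    -- the seam's other inputs
    (hSh : ShellWeightBound l₀ T A A' shA shB Wsh)
    (hTB : ReindexedBudget l₀ vol T (fun K t τ => A K t τ - shA K t τ) (fun K t τ => A' K t τ - shB K t τ)
      (badOfClass (bstrOf Prod.fst (memOf ped liveC (cellOfR n F.L (runProfile F.L R) ped cellP))) T
        (fun K _ => badClasses Prod.fst (memOf ped liveC (cellOfR n F.L (runProfile F.L R) ped cellP)) jhalf T K)) Cc Rr CcRec RrRec ν u s₂ q₀ r s)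
    (hr : Summable r) (hu : Summable u) (hs : Summable s) (hs₂ : Summable s₂) :
    ∃ K₁ K₂, K₀ ≤ K₁ ∧ HybridNE7 l₀ vol (fun K => T (K₁ + (K₂ + K))) (fun K => A (K₁ + (K₂ + K)))
      (fun K => A' (K₁ + (K₂ + K)))
      (fun K => badOfClass (bstrOf Prod.fst (memOf ped liveC (cellOfR n F.L (runProfile F.L R) ped cellP))) T
        (fun K _ => badClasses Prod.fst (memOf ped liveC (cellOfR n F.L (runProfile F.L R) ped cellP)) jhalf T K) (K₁ + (K₂ + K)))
      (fun K => constOf l₀ B (max (em g) 0) n₁ c₀ Nup *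
        recordsBudget (birthMass C) C.κ₁ ((n : ℝ) ^ d) ((F.L : ℝ) ^ d) (Real.log 2) jhalf (K₁ + (K₂ + K)))
      (fun K => shA (K₁ + (K₂ + K))) (fun K => shB (K₁ + (K₂ + K))) (fun K => Wsh (K₁ + (K₂ + K)))
      (fun K => (r (K₁ + (K₂ + K)) + u (K₁ + (K₂ + K))) + (s (K₁ + (K₂ + K)) + s₂ (K₁ + (K₂ + K)))) := by
  -- the run's profile is stepwise non-increasing (from the flow below the cutoff, constant beyond) and drop-controlled
  have hprof : ∀ K, K₀ ≤ K → ∀ t, runProfile F.L R K (t + 1) ≤ runProfile F.L R K t := fun K _ t => by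
    by_cases htK : t < K
    · exact runProfile_succ_le D hb hlo hhi hγ hγβ S ht R hR K t htK
    · show expOf F.L (R K) (min (t + 1) K) ≤ expOf F.L (R K) (min t K)
      rw [min_eq_right (by omega), min_eq_right (by omega)]
  have hdropR : ∀ K, K₀ ≤ K → ∀ m, DropCtl (runProfile F.L R K) m := fun K _ =>
    dropCtl_runProfile D hb hlo hhi hγ hγβ S hrr hβ ht R hR K
  have hMf : ∀ K, K₀ ≤ K → ∀ τ ∈ T K, ∀ c ∈ liveC K τ, ∀ bz ∈ ((ped K τ).toPGen (cellP K τ) c).pbirths,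
      tcap d bz.1.fat ≤ (fun K => tcap d (dcapOf Prod.fst T (memOf ped liveC (cellOfR n F.L (runProfile F.L R) ped cellP)) K)) K :=
    fun K hK τ hτ c hc bz hbz => tcap_mono d (le_of_lt (fat_lt_dcapOf_of_mem_pbirths
      (fun K hK τ hτ => H.renew_step K hK τ hτ) (cellOfR n F.L (runProfile F.L R) ped cellP) hK hτ hc hbz))
  exact hybridNE7_of_realisedDomainsRunW_printedMult D h hμ d n hκ₁ hE₀ hA₀ hb hlo hhi hγ hγβ S hp₀ hrr hβ ht hir hsign hcor
    hγB hobs hbd hα hα' hc₀ hfloor hfloor' hsites hsites' hNup hnup hmup R hR hL4 hn₁ hR1 ped cellP liveC Zd H hn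
    (physV n F.L hn (Nat.lt_of_lt_of_le Nat.zero_lt_two (two_le_L F))
        (fun K => tcap d (dcapOf Prod.fst T (memOf ped liveC (cellOfR n F.L (runProfile F.L R) ped cellP)) K))
        (fun K => one_le_tcap d (dcapOf Prod.fst T (memOf ped liveC (cellOfR n F.L (runProfile F.L R) ped cellP)) K)) (runProfile F.L R) ped cellP)
    hθ hslack (Λm := (F.L : ℝ) ^ d) (Λr := 1) (by positivity) zero_le_one (by rw [mul_one]) κ κ' hκ hκ'
    (fun K q => (8 / C.E₂ * totalCostT Prod.fst C K (R K) q.2 + 4 * (partnerAges (PEv.step ∘ Prod.fst) q.2 : ℝ)))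
    (fun K hK τ hτ c hc => card_koccOf_le_expW hn (Nat.lt_of_lt_of_le Nat.zero_lt_two (two_le_L F)) hL4 hn₁ hE₂ hE₃
      (fun K => one_le_tcap d (dcapOf Prod.fst T (memOf ped liveC (cellOfR n F.L (runProfile F.L R) ped cellP)) K)) hprof hdropR hR1 H hstep hMf jhalf hdis hsS
      hsmall hθc0 hθc1 hθcs hθJ hK hτ hc)
    hPM hPM' upM deadM_nonneg resumM FM_nonneg upM' deadM'_nonneg resumM' FM'_nonneg hSh hTB hr hu hs hs₂

end End

end

end Summit.QuantumFields.BalabanUV.T4Continuum.HistoryRealiseCellsRunMultEndW
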